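import Summits.Langlands.Statement
import Summits.Langlands.Langlands.Theorems.IrreducibilityBySelfDualityReciprocityUpToIrreducibilityGeometricConstituentsDevissage
import HarnessLib

/-!
# Irreducible geometric constituents of a geometric Galois representation
(crux `IrreducibilityBySelfDuality.ReciprocityUpToIrreducibility`, item stmt-Langlands-14328, line
`Sketch`, stub `stub_geometricConstituents` = P1)

Let `ρ : Γ_K →ₜ* GL_n(ℚ̄_ℓ)` (`n ≥ 1`) be PINNED-GEOMETRIC: unramified at almost all finite places and
de Rham at every `v ∣ ℓ` for Fontaine's pinned datum `fontainePstAdicCompletion v ℓ hv`.  GIVEN de Rham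
heredity for block upper triangular framed representations of local Galois groups (the antecedent
`D1`, Fontaine, Astérisque 223, Exp. III Prop. 1.5.2 — it is the neighbouring stub `stub_deRhamBlocks`
and enters here as a hypothesis), `ρ` has finitely many IRREDUCIBLE pinned-geometric framed
constituents `r i : Γ_K →ₜ* GL_{m_i}(ℚ̄_ℓ)`, `m_i ≥ 1`, with `det(X - ρ(g)) = ∏ det(X - r_i(g))` for
every `g`, unramified wherever `ρ` is, and `ρ` irreducible when there is exactly one of them
(`stub_geometricConstituents`).  Proof: strong induction on `n` (Jordan–Hölder dévissage).  If `ρ` is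
reducible, the continuous dévissage with the change of frame recorded
(`exists_conj_continuous_blocks_of_subrepresentation`) gives `P` with `P ρ P⁻¹` block upper
triangular with continuous diagonal blocks `A`, `D` of smaller positive ranks; they are unramified
wherever `ρ` is (`ρ σ = 1 ⇒ A σ = 1 ∧ D σ = 1`), and de Rham at `v ∣ ℓ` by frame invariance of
`IsDeRhamFramed` (`HasQlModel` composes with `conj`), `toLocal ∘ conj = conj ∘ toLocal`, and `D1`
applied over `K_v`; recurse on `A` and `D` and concatenate the two families (`Fin.addCases`,
`Fin.prod_univ_add`).

References: C. W. Curtis, I. Reiner, *Methods of Representation Theory* I (1981), §16B;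
J.-M. Fontaine, Astérisque 223 (1994), Exp. III, Prop. 1.5.2.
-/

noncomputable section

set_option linter.dupNamespace false -- project-wide option (lakefile weak.linter.dupNamespace); `Summit.Langlands.Langlands` is the mandated namespace

open scoped NumberField Classical Polynomial MatrixGroups
open Filter IsDedekindDomain Polynomial
open Literature.NumberTheory.Automorphic Literature.NumberTheory.GaloisRepresentations
open Summit.Langlands

namespace Summit.Langlands.Langlands.Theorems.ReciprocityUpToIrreducibility

/-! ### Frame invariance of de Rham-ness and restriction to decomposition groups -/

section Local

variable {F : Type} [Field F] [ValuativeRel F] [TopologicalSpace F] [IsNonarchimedeanLocalField F]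
  {ℓ : ℕ} [Fact ℓ.Prime]

/-- **De Rham-ness does not see the frame**: `𝔇.IsDeRhamFramed ρ → 𝔇.IsDeRhamFramed (P ρ P⁻¹)`
(a `ℚ_ℓ`-model of `ρ` is one of `P ρ P⁻¹`, `HasQlModel` composing with `conj`). [folklore] -/
theorem isDeRhamFramed_conj (𝔇 : PstWeilDeligneData F ℓ) {n : ℕ} (P : GL (Fin n) (PadicAlgCl ℓ))
    {ρ : FramedRep (Field.absoluteGaloisGroup F) (PadicAlgCl ℓ) n} (h : 𝔇.IsDeRhamFramed ρ) :
    𝔇.IsDeRhamFramed (FramedRep.conj P ρ) := by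
  obtain ⟨E, hE, rE, ⟨P₀, hP₀⟩, hdR⟩ := h
  exact ⟨E, hE, rE, ⟨P * P₀, by rw [← conj_conj_eq_conj_mul, hP₀]⟩, hdR⟩

end Local

section Global

variable {K : Type} [Field K] [NumberField K] {ℓ : ℕ} [Fact ℓ.Prime]

/-- Restriction to a decomposition group commutes with change of frame. [folklore] -/
theorem toLocal_conj {n : ℕ} (v : HeightOneSpectrum (𝓞 K)) (P : GL (Fin n) (PadicAlgCl ℓ))
    (ρ : FramedGaloisRep K (PadicAlgCl ℓ) n) :
    FramedGaloisRep.toLocal v (FramedRep.conj P ρ) = FramedRep.conj P (ρ.toLocal v) := rfl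

omit [NumberField K] in
/-- **Unramifiedness of the diagonal blocks**: if `P ρ P⁻¹` is block upper triangular with diagonal
blocks `A`, `D` and `ρ` is unramified at `v`, so are `A` and `D` (inertia maps to `1`, and
`P 1 P⁻¹ = 1` has diagonal blocks `1`). [folklore] -/
theorem isUnramifiedAt_blocks {m p n : ℕ} (e : Fin m ⊕ Fin p ≃ Fin n) (P : GL (Fin n) (PadicAlgCl ℓ))
    (ρ : FramedGaloisRep K (PadicAlgCl ℓ) n) (A : FramedGaloisRep K (PadicAlgCl ℓ) m)
    (D : FramedGaloisRep K (PadicAlgCl ℓ) p)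
    (hT : ∀ g, ∃ B : Matrix (Fin m) (Fin p) (PadicAlgCl ℓ),
      ((FramedRep.conj P ρ g : GL (Fin n) (PadicAlgCl ℓ)) : Matrix (Fin n) (Fin n) (PadicAlgCl ℓ)) =
        Matrix.reindex e e (Matrix.fromBlocks
          ((A g : GL (Fin m) (PadicAlgCl ℓ)) : Matrix (Fin m) (Fin m) (PadicAlgCl ℓ)) B 0
          ((D g : GL (Fin p) (PadicAlgCl ℓ)) : Matrix (Fin p) (Fin p) (PadicAlgCl ℓ))))
    {v : HeightOneSpectrum (𝓞 K)} (hv : ρ.IsUnramifiedAt v) :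
    A.IsUnramifiedAt v ∧ D.IsUnramifiedAt v :=
  ⟨fun 𝔓 h𝔓 σ hσ ↦
      (eq_one_of_blockTriangular e _ A D hT (conj_apply_eq_one P ρ (hv 𝔓 h𝔓 σ hσ))).1,
    fun 𝔓 h𝔓 σ hσ ↦
      (eq_one_of_blockTriangular e _ A D hT (conj_apply_eq_one P ρ (hv 𝔓 h𝔓 σ hσ))).2⟩

/-- **De Rham heredity of the diagonal blocks at `v ∣ ℓ`, from the antecedent `D1`** (Fontaine,
Astérisque 223, Exp. III Prop. 1.5.2, taken as a hypothesis): `ρ|_{Γ_{K_v}}` de Rham ⇒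
`(P ρ P⁻¹)|_{Γ_{K_v}} = P ρ|_{Γ_{K_v}} P⁻¹` de Rham (frame invariance) ⇒ its diagonal blocks
`A|_{Γ_{K_v}}`, `D|_{Γ_{K_v}}` are de Rham (`D1` over the local field `K_v`). [folklore] -/
theorem isDeRhamFramed_blocks
    (hD1 : ∀ (F : Type) [Field F] [ValuativeRel F] [TopologicalSpace F] [IsNonarchimedeanLocalField F]
      (ℓ : ℕ) [Fact ℓ.Prime] (𝔇 : PstWeilDeligneData F ℓ) (m p n : ℕ) (e : Fin m ⊕ Fin p ≃ Fin n)
      (T : FramedRep (Field.absoluteGaloisGroup F) (PadicAlgCl ℓ) n)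
      (A : FramedRep (Field.absoluteGaloisGroup F) (PadicAlgCl ℓ) m)
      (D : FramedRep (Field.absoluteGaloisGroup F) (PadicAlgCl ℓ) p),
      (∀ g, ∃ B : Matrix (Fin m) (Fin p) (PadicAlgCl ℓ),
        ((T g : GL (Fin n) (PadicAlgCl ℓ)) : Matrix (Fin n) (Fin n) (PadicAlgCl ℓ)) =
          Matrix.reindex e e (Matrix.fromBlocks
            ((A g : GL (Fin m) (PadicAlgCl ℓ)) : Matrix (Fin m) (Fin m) (PadicAlgCl ℓ)) B 0
            ((D g : GL (Fin p) (PadicAlgCl ℓ)) : Matrix (Fin p) (Fin p) (PadicAlgCl ℓ)))) →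
      𝔇.IsDeRhamFramed T → 𝔇.IsDeRhamFramed A ∧ 𝔇.IsDeRhamFramed D)
    {m p n : ℕ} (e : Fin m ⊕ Fin p ≃ Fin n) (P : GL (Fin n) (PadicAlgCl ℓ))
    (ρ : FramedGaloisRep K (PadicAlgCl ℓ) n) (A : FramedGaloisRep K (PadicAlgCl ℓ) m)
    (D : FramedGaloisRep K (PadicAlgCl ℓ) p)
    (hT : ∀ g, ∃ B : Matrix (Fin m) (Fin p) (PadicAlgCl ℓ),
      ((FramedRep.conj P ρ g : GL (Fin n) (PadicAlgCl ℓ)) : Matrix (Fin n) (Fin n) (PadicAlgCl ℓ)) =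
        Matrix.reindex e e (Matrix.fromBlocks
          ((A g : GL (Fin m) (PadicAlgCl ℓ)) : Matrix (Fin m) (Fin m) (PadicAlgCl ℓ)) B 0
          ((D g : GL (Fin p) (PadicAlgCl ℓ)) : Matrix (Fin p) (Fin p) (PadicAlgCl ℓ))))
    (v : HeightOneSpectrum (𝓞 K)) (hv : ((ℓ : ℕ) : 𝓞 K) ∈ v.asIdeal)
    (hdR : (Literature.NumberTheory.PAdicHodge.fontainePstAdicCompletion v ℓ hv).IsDeRhamFramed
      (ρ.toLocal v)) :
    (Literature.NumberTheory.PAdicHodge.fontainePstAdicCompletion v ℓ hv).IsDeRhamFramed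
        (A.toLocal v) ∧
      (Literature.NumberTheory.PAdicHodge.fontainePstAdicCompletion v ℓ hv).IsDeRhamFramed
        (D.toLocal v) :=
  hD1 (v.adicCompletion K) ℓ (Literature.NumberTheory.PAdicHodge.fontainePstAdicCompletion v ℓ hv)
    m p n e (FramedGaloisRep.toLocal v (FramedRep.conj P ρ)) (A.toLocal v) (D.toLocal v)
    (fun σ ↦ hT _) (by rw [toLocal_conj]; exact isDeRhamFramed_conj _ P hdR)

/-! ### The dévissage induction -/

/-- **Irreducible pinned-geometric constituents (with `0 < k`), by strong induction on the rank.**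
If `ρ` is irreducible take `k = 1`, `r 0 = ρ`.  Otherwise `ℚ̄_ℓⁿ` has a proper non-zero stable
subspace; the continuous dévissage with the change of frame recorded gives `P ρ P⁻¹` block upper
triangular with continuous diagonal blocks `A`, `D` of smaller positive ranks, with
`det(X - ρ g) = det(X - A g) det(X - D g)`, unramified wherever `ρ` is and de Rham at `v ∣ ℓ` (from
`D1`); recurse on `A`, `D` and concatenate. [folklore] -/
theorem exists_geometricConstituents
    (hD1 : ∀ (F : Type) [Field F] [ValuativeRel F] [TopologicalSpace F] [IsNonarchimedeanLocalField F]
      (ℓ : ℕ) [Fact ℓ.Prime] (𝔇 : PstWeilDeligneData F ℓ) (m p n : ℕ) (e : Fin m ⊕ Fin p ≃ Fin n)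
      (T : FramedRep (Field.absoluteGaloisGroup F) (PadicAlgCl ℓ) n)
      (A : FramedRep (Field.absoluteGaloisGroup F) (PadicAlgCl ℓ) m)
      (D : FramedRep (Field.absoluteGaloisGroup F) (PadicAlgCl ℓ) p),
      (∀ g, ∃ B : Matrix (Fin m) (Fin p) (PadicAlgCl ℓ),
        ((T g : GL (Fin n) (PadicAlgCl ℓ)) : Matrix (Fin n) (Fin n) (PadicAlgCl ℓ)) =
          Matrix.reindex e e (Matrix.fromBlocks
            ((A g : GL (Fin m) (PadicAlgCl ℓ)) : Matrix (Fin m) (Fin m) (PadicAlgCl ℓ)) B 0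
            ((D g : GL (Fin p) (PadicAlgCl ℓ)) : Matrix (Fin p) (Fin p) (PadicAlgCl ℓ)))) →
      𝔇.IsDeRhamFramed T → 𝔇.IsDeRhamFramed A ∧ 𝔇.IsDeRhamFramed D)
    (K : Type) [Field K] [NumberField K] (ℓ : ℕ) [Fact ℓ.Prime] {n : ℕ}
    (ρ : FramedGaloisRep K (PadicAlgCl ℓ) n) (hn : 0 < n)
    (hgeo : (∀ᶠ v : HeightOneSpectrum (𝓞 K) in cofinite, ρ.IsUnramifiedAt v) ∧
      ∀ (v : HeightOneSpectrum (𝓞 K)) (hv : ((ℓ : ℕ) : 𝓞 K) ∈ v.asIdeal),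
        (Literature.NumberTheory.PAdicHodge.fontainePstAdicCompletion v ℓ hv).IsDeRhamFramed
          (ρ.toLocal v)) :
    ∃ (k : ℕ) (m : Fin k → ℕ) (r : ∀ i, FramedGaloisRep K (PadicAlgCl ℓ) (m i)), 0 < k ∧
      (∀ i, 0 < m i ∧ (r i).toGaloisRep.IsIrreducible ∧
        ((∀ᶠ v : HeightOneSpectrum (𝓞 K) in cofinite, (r i).IsUnramifiedAt v) ∧
          ∀ (v : HeightOneSpectrum (𝓞 K)) (hv : ((ℓ : ℕ) : 𝓞 K) ∈ v.asIdeal),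
            (Literature.NumberTheory.PAdicHodge.fontainePstAdicCompletion v ℓ hv).IsDeRhamFramed
              ((r i).toLocal v))) ∧
      (∀ g : Field.absoluteGaloisGroup K, ρ.charpoly g = ∏ i, (r i).charpoly g) ∧
      (∀ v : HeightOneSpectrum (𝓞 K), ρ.IsUnramifiedAt v → ∀ i, (r i).IsUnramifiedAt v) ∧
      (k = 1 → ρ.toGaloisRep.IsIrreducible) := by
  induction n using Nat.strong_induction_on with
  | _ n ih =>
    by_cases hirr : ρ.toGaloisRep.IsIrreducible
    · refine ⟨1, fun _ ↦ n, fun _ ↦ ρ, one_pos, fun _ ↦ ⟨hn, hirr, hgeo⟩, fun g ↦ ?_,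
        fun v hv _ ↦ hv, fun _ ↦ hirr⟩
      rw [Fin.prod_univ_one]
    -- a proper non-zero stable subspace of `ℚ̄_ℓⁿ`
    have hirr' : ¬ IsSimpleOrder (Subrepresentation (FramedRep.toRepresentation ρ)) := hirr
    have hW : ∃ W : Subrepresentation (FramedRep.toRepresentation ρ), W ≠ ⊥ ∧ W ≠ ⊤ := by
      by_contra hcon
      push Not at hcon
      have hbt : (⊥ : Subrepresentation (FramedRep.toRepresentation ρ)) ≠ ⊤ := by
        intro h
        have h' := congrArg Subrepresentation.toSubmodule h
        change (⊥ : Submodule (PadicAlgCl ℓ) (Fin n → PadicAlgCl ℓ)) = ⊤ at h'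
        haveI : Nonempty (Fin n) := ⟨⟨0, hn⟩⟩
        exact bot_ne_top h'
      haveI : Nontrivial (Subrepresentation (FramedRep.toRepresentation ρ)) := ⟨⟨⊥, ⊤, hbt⟩⟩
      exact hirr' ⟨fun W ↦ or_iff_not_imp_left.mpr (hcon W)⟩
    obtain ⟨W, hW0, hW1⟩ := hW
    -- continuous dévissage with the change of frame recorded
    obtain ⟨m, p, hm0, hp0, hmn, hpn, e, P, A, D, hT⟩ :=
      exists_conj_continuous_blocks_of_subrepresentation (k := PadicAlgCl ℓ) ρ W hW0 hW1
    have hcp : ∀ g, ρ.charpoly g = FramedRep.charpoly A g * FramedRep.charpoly D g := fun g ↦ by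
      rw [← charpoly_conj_eq P ρ g]
      exact charpoly_eq_mul_of_blockTriangular e _ A D hT g
    have hur : ∀ v : HeightOneSpectrum (𝓞 K), ρ.IsUnramifiedAt v →
        FramedGaloisRep.IsUnramifiedAt v A ∧ FramedGaloisRep.IsUnramifiedAt v D :=
      fun v hv ↦ isUnramifiedAt_blocks e P ρ A D hT hv
    have hdR := fun v hv ↦ isDeRhamFramed_blocks hD1 e P ρ A D hT v hv (hgeo.2 v hv)
    -- recurse on the two diagonal blocks (pinned-geometric of smaller positive rank)
    obtain ⟨k₁, m₁, r₁, hk₁, hr₁, hcp₁, hur₁, -⟩ := ih m hmn A hm0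
      ⟨hgeo.1.mono fun v hv ↦ (hur v hv).1, fun v hv ↦ (hdR v hv).1⟩
    obtain ⟨k₂, m₂, r₂, hk₂, hr₂, hcp₂, hur₂, -⟩ := ih p hpn D hp0
      ⟨hgeo.1.mono fun v hv ↦ (hur v hv).2, fun v hv ↦ (hdR v hv).2⟩
    -- concatenate the two families (as one family of dependent pairs `⟨m i, r i⟩`)
    let mr : Fin (k₁ + k₂) → (Σ d : ℕ, FramedGaloisRep K (PadicAlgCl ℓ) d) :=
      Fin.addCases (fun i ↦ ⟨m₁ i, r₁ i⟩) (fun i ↦ ⟨m₂ i, r₂ i⟩)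
    have hmr₁ : ∀ i, mr (Fin.castAdd k₂ i) = ⟨m₁ i, r₁ i⟩ := fun i ↦ Fin.addCases_left i
    have hmr₂ : ∀ i, mr (Fin.natAdd k₁ i) = ⟨m₂ i, r₂ i⟩ := fun i ↦ Fin.addCases_right i
    have hQ : ∀ i, 0 < (mr i).1 ∧ (mr i).2.toGaloisRep.IsIrreducible ∧
        ((∀ᶠ v : HeightOneSpectrum (𝓞 K) in cofinite, (mr i).2.IsUnramifiedAt v) ∧
          ∀ (v : HeightOneSpectrum (𝓞 K)) (hv : ((ℓ : ℕ) : 𝓞 K) ∈ v.asIdeal),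
            (Literature.NumberTheory.PAdicHodge.fontainePstAdicCompletion v ℓ hv).IsDeRhamFramed
              ((mr i).2.toLocal v)) := by
      intro i
      refine Fin.addCases (fun i ↦ ?_) (fun i ↦ ?_) i
      · rw [hmr₁]
        exact hr₁ i
      · rw [hmr₂]
        exact hr₂ i
    have hprod : ∀ g : Field.absoluteGaloisGroup K, ρ.charpoly g = ∏ i, (mr i).2.charpoly g := by
      intro g
      rw [hcp g, Fin.prod_univ_add, hcp₁ g, hcp₂ g]
      congr 1
      · exact Finset.prod_congr rfl fun i _ ↦ by rw [hmr₁]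
      · exact Finset.prod_congr rfl fun i _ ↦ by rw [hmr₂]
    have hU : ∀ v : HeightOneSpectrum (𝓞 K), ρ.IsUnramifiedAt v →
        ∀ i, (mr i).2.IsUnramifiedAt v := by
      intro v hv i
      refine Fin.addCases (fun i ↦ ?_) (fun i ↦ ?_) i
      · rw [hmr₁]
        exact hur₁ v (hur v hv).1 i
      · rw [hmr₂]
        exact hur₂ v (hur v hv).2 i
    exact ⟨k₁ + k₂, fun i ↦ (mr i).1, fun i ↦ (mr i).2, by omega, hQ, hprod, hU,
      fun h ↦ absurd h (by omega)⟩

/-! ### The registered stub -/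

/-- **Stub P1 `stub_geometricConstituents`** of the line `Sketch` for the crux
`ReciprocityUpToIrreducibility`: GIVEN de Rham heredity for block upper triangular framed
representations of local Galois groups (the antecedent, Fontaine, Astérisque 223, Exp. III
Prop. 1.5.2 = the neighbouring stub `stub_deRhamBlocks`), every pinned-geometric
`ρ : Γ_K →ₜ* GL_n(ℚ̄_ℓ)`, `n ≥ 1`, has irreducible pinned-geometric framed constituents whose
characteristic polynomials multiply to its own at every element, unramified wherever `ρ` is, and `ρ` is
irreducible if there is exactly one.  Immediate from `exists_geometricConstituents`. [folklore] -/
theorem stub_geometricConstituents :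
    (∀ (F : Type) [Field F] [ValuativeRel F] [TopologicalSpace F] [IsNonarchimedeanLocalField F]
      (ℓ : ℕ) [Fact ℓ.Prime] (𝔇 : PstWeilDeligneData F ℓ) (m p n : ℕ) (e : Fin m ⊕ Fin p ≃ Fin n)
      (T : FramedRep (Field.absoluteGaloisGroup F) (PadicAlgCl ℓ) n)
      (A : FramedRep (Field.absoluteGaloisGroup F) (PadicAlgCl ℓ) m)
      (D : FramedRep (Field.absoluteGaloisGroup F) (PadicAlgCl ℓ) p),
      (∀ g, ∃ B : Matrix (Fin m) (Fin p) (PadicAlgCl ℓ),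
        ((T g : GL (Fin n) (PadicAlgCl ℓ)) : Matrix (Fin n) (Fin n) (PadicAlgCl ℓ)) =
          Matrix.reindex e e (Matrix.fromBlocks
            ((A g : GL (Fin m) (PadicAlgCl ℓ)) : Matrix (Fin m) (Fin m) (PadicAlgCl ℓ)) B 0
            ((D g : GL (Fin p) (PadicAlgCl ℓ)) : Matrix (Fin p) (Fin p) (PadicAlgCl ℓ)))) →
      𝔇.IsDeRhamFramed T → 𝔇.IsDeRhamFramed A ∧ 𝔇.IsDeRhamFramed D) →
    ∀ (K : Type) [Field K] [NumberField K] (ℓ : ℕ) [Fact ℓ.Prime] (n : ℕ)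
      (ρ : FramedGaloisRep K (PadicAlgCl ℓ) n), 0 < n →
      ((∀ᶠ v : HeightOneSpectrum (𝓞 K) in cofinite, ρ.IsUnramifiedAt v) ∧
        ∀ (v : HeightOneSpectrum (𝓞 K)) (hv : ((ℓ : ℕ) : 𝓞 K) ∈ v.asIdeal),
          (Literature.NumberTheory.PAdicHodge.fontainePstAdicCompletion v ℓ hv).IsDeRhamFramed
            (ρ.toLocal v)) →
      ∃ (k : ℕ) (m : Fin k → ℕ) (r : ∀ i, FramedGaloisRep K (PadicAlgCl ℓ) (m i)),
        (∀ i, 0 < m i ∧ (r i).toGaloisRep.IsIrreducible ∧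
          ((∀ᶠ v : HeightOneSpectrum (𝓞 K) in cofinite, (r i).IsUnramifiedAt v) ∧
            ∀ (v : HeightOneSpectrum (𝓞 K)) (hv : ((ℓ : ℕ) : 𝓞 K) ∈ v.asIdeal),
              (Literature.NumberTheory.PAdicHodge.fontainePstAdicCompletion v ℓ hv).IsDeRhamFramed
                ((r i).toLocal v))) ∧
        (∀ g : Field.absoluteGaloisGroup K, ρ.charpoly g = ∏ i, (r i).charpoly g) ∧
        (∀ v : HeightOneSpectrum (𝓞 K), ρ.IsUnramifiedAt v → ∀ i, (r i).IsUnramifiedAt v) ∧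
        (k = 1 → ρ.toGaloisRep.IsIrreducible) := by
  intro hD1 K _ _ ℓ _ n ρ hn hgeo
  obtain ⟨k, m, r, -, hr, hcp, hur, hone⟩ := exists_geometricConstituents hD1 K ℓ ρ hn hgeo
  exact ⟨k, m, r, hr, hcp, hur, hone⟩

end Global

end Summit.Langlands.Langlands.Theorems.ReciprocityUpToIrreducibility

end
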